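import Summits.QuantumFields.YangMills.Theses.ConvexGribovBody
import Summits.QuantumFields.YangMills.Theorems.ConvexGribovBodyBrascampLiebVacuumStubCondVarTelescope
import Summits.QuantumFields.YangMills.Theorems.ConvexGribovBodyBrascampLiebVacuumStubBavgMeasurable
import Summits.QuantumFields.YangMills.Theorems.ConvexGribovBodyBrascampLiebVacuumStubAdmissibleMemLp
import Literature.MathematicalPhysics.QuantumFieldTheory.UnevenAxialBlocking
import Literature.MathematicalPhysics.QuantumFieldTheory.LatticeGaugeProofs
import Literature.MathematicalPhysics.QuantumFieldTheory.BalabanBlockSpecification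

/-!
# Crux `BrascampLiebVacuum` (stmt-QuantumFields-8779) via the line `per-scale-brascamp-lieb`
— skeleton v2 (line lead c3, 2026-08-16; = a1/v1b with the three landed mathematical stubs imported and the
unused binder `fun j w` of the `taxi` lets renamed `fun _ w`, which the unused-variables lint would otherwise flag
in every sorry-free proof of a physics stub)

Route `ConvexGribovBody` of `YangMills`; crux (concluded BY NAME in `BrascampLiebVacuum_of`):
`Summit.QuantumFields.YangMills.Theses.ConvexGribovBody.BrascampLiebVacuum` — the volume-uniform
weak-coupling Poincaré inequality `Var_μ f ≤ C · Dmax · dir f` for gauge-invariant link-Lipschitz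
functions `f` of the time-zero spatial links under Wilson's measure `μ` on the torus `(2S+1)⁴`.

## The line (card `Ideas/per-scale-brascamp-lieb.md`, line card `Lines/per-scale-brascamp-lieb.md`)

Block-averaging variance martingale, typed as a three-range scale split plus local relaxation.
Objects (all inline `let`s, no definition item):
* `bavg j U (y, ν)` — Bałaban's UNPROJECTED covariant matrix block average at the dyadic scale
  `2^j` of the 4d field: the mean over the `(2^j)^4` offsets `w` of the corner sub-cube of the block
  `y` of `r.ρ` of the dressed transporter `U(Γ_{by,w}) · U(straight segment) · U(Γ_{b(y+e_ν),w})⁻¹`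
  (taxi path inside the block, straight segment of `unevenLen` steps, taxi path back in the
  neighbouring block), over the tree's UNEVEN block geometry `unevenCorner`/`unevenLen` (blocks per
  side `T j = (2S+1)/2^j`, the last block absorbing the remainder) and `QuantumLattice.transport`;
* `m k = ⨆_{k ≤ j ≤ Kmax} σ(bavg j)`, `Kmax = log₂(2S+1)` — a decreasing filtration by construction;
* `Dp p = ∫ sup_{h ∈ argmin coul} cov U h p dμ` (the crux's covariance at momentum `p`, so that
  `Dmax = ⨆_p Dp p` verbatim), sup-norm shells `S/2^{k+1} < |p|_∞ ≤ S/2^k` (`ZMod.valMinAbs`),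
  `Dsh k` = sup over the shell, `DUV k` = sup over `|p|_∞ > S/2^{k+1}`;
* the PEAK SCALE `K`: `K ≤ Kmax`, `Dsh` grows by the factor `5/4` below `K` (`hgrowth`) and stops
  at `K` or `K = Kmax` (`hstop`) — hypotheses of every lattice stub, produced by `Nat.find` here;
* `LocalAt ℓ g`: `g` depends only on the time-zero spatial links based in a spatial cube of side `ℓ`.

Registered stubs (7 = stubs_max; the 3 mathematical ones LANDED in wave 1 of lead a1 and are IMPORTED here — 4 sorries remain, all physics):
* PHYSICS — `stub_uvCascade` (`E(f − E[f|m(K−A)])² ≤ C_UV·(DUV(K−A) + Λ)·dir f` given the local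
  Poincaré constant `Λ` at cubes `≤ min(c₀2^{K−A}, S)`; Bałaban regime, XL, NOT implied by the crux),
  `stub_crossover` (`E(E[f|m(K−A)] − E[f|m K])² ≤ C_X·(DUV K + Λ)·dir f`), `stub_localRelaxation`
  (`Var g ≤ C_T·Dmax·dir g` for local admissible `g`, implied by the crux), `stub_coarsePoincare`
  (`Var(E[f|m K]) ≤ C_IR·Dmax·dir f`, TARGET strength, implied by the crux);
* MATHEMATICS — `stub_condVarTelescope` (orthogonality of martingale differences:
  `Var f = E(f−E₁f)² + E(E₁f−E₂f)² + Var(E₂ f)` for `m₂ ≤ m₁ ≤ m0`, `f ∈ L²`; Mathlib's law of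
  total variance twice), `stub_bavgMeasurable` (each `bavg j` is Borel measurable — continuity of
  `transport` and `r.ρ`), `stub_admissibleMemLp` (link-Lipschitz `f` is bounded and continuous, hence
  in `L²(μ)`).
* `BrascampLiebVacuum_of`: `Var f = Σ three pieces ≤ [C_UV(1+C_T) + C_X(1+C_T) + C_IR]·Dmax·dir f`
  with `Λ := C_T·Dmax`, `DUV ≤ Dmax` (`Real.iSup_le`), `0 ≤ dir f`, `0 ≤ Dmax`.

Reshape w.r.t. the planner's v2 (evidence `20260816T171144Z-line-per-scale-brascamp-lieb.lean`, not
readable from this seat's jail; `Lines/per-scale-brascamp-lieb.lean` not yet in the tree): the three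
scale pieces are typed in their natural conditional-variance form instead of as differences of
carried variances `Vc j f − Vc k f`; the two typings agree by `stub_condVarTelescope`, which is now a
registered, provable stub used by the composition (the card's (M)), together with the two
measurability/integrability facts that make `μ[f|m k]` the genuine conditional expectation.

Disproof used (`Cruxes/BrascampLiebVacuum/Disproof.lean`): F2 (ii)/(iii) honoured — the `t = 0`
clause and the Lipschitz clause are kept verbatim for `f` and for the local `g`; F3 (`∃ C` before
`∀ β`) is inherited verbatim by the four physics stubs (constants before `β`); `Negative/*` not
imported (nothing to shortcut).
-/

open scoped BigOperators Topology Matrix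
open Filter MeasureTheory
open Literature.MathematicalPhysics.QuantumFieldTheory
open Literature.MathematicalPhysics.QuantumLattice (transport pathEnd)

noncomputable section

namespace Summit.QuantumFields.YangMills.Theorems.BrascampLiebVacuum

/-! ### Mathematical stubs — LANDED (wave 1 of lead a1) and imported:
`stub_condVarTelescope` (p118256, `Theorems/ConvexGribovBodyBrascampLiebVacuumStubCondVarTelescope.lean`),
`stub_bavgMeasurable` (p118947, `…StubBavgMeasurable.lean`),
`stub_admissibleMemLp` (p118952, `…StubAdmissibleMemLp.lean`). -/

/-! ### Physics stubs (functionals of the explicit four-dimensional Wilson measure) -/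

/-- **Stub (PHYSICS — ultraviolet cascade; Bałaban regime, the line's load-bearing reduction).**
There are a buffer `A`, a locality factor `c₀ > 0` and `C_UV > 0` such that for `β ≥ β₀`,
`S ≥ S₀(β)`, every peak scale `K` (growth of the shell covariances `Dsh` by `5/4` below `K`, stop at
`K`) and every `Λ ≥ 0` dominating the Poincaré ratio of the gauge-invariant link-Lipschitz functions
of the time-zero spatial links of cubes of side `≤ min(c₀ 2^{K−A}, S)`: for all admissible `f`,
`E_μ (f − E_μ[f | m (K−A)])² ≤ C_UV · (DUV (K−A) + Λ) · dir f` — the variance NOT explained by the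
covariant block averages at scales `≥ 2^{K−A}` costs only the covariance ABOVE that scale plus the
local constant. Not implied by the crux (`DUV ≪ Dmax`). [folklore] -/
theorem stub_uvCascade :
    ∀ (G : Type) [Group G] [TopologicalSpace G] [IsTopologicalGroup G] [CompactSpace G]
      [MeasurableSpace G] [BorelSpace G], IsCompactSimpleLieGroup G → ∀ r : LatticeRep G,
      ∃ A c₀ : ℕ, ∃ C_UV : ℝ, 0 < c₀ ∧ 0 < C_UV ∧ ∃ β₀ : ℝ, ∀ β : ℝ, β₀ ≤ β →
      ∃ S₀ : ℕ, ∀ S : ℕ, S₀ ≤ S →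
      let μ := wilsonMeasure (d := 4) (L := 2 * S + 1) r.ρ β
      let fro : Matrix (Fin r.N) (Fin r.N) ℂ → ℝ := fun M => ∑ a, ∑ b, ‖M a b‖ ^ 2
      let coul : GaugeConfig 4 (2 * S + 1) G → (Site 4 (2 * S + 1) → G) → ℝ := fun U h =>
        -∑ e : Edge 4 (2 * S + 1),
          (if e.1 0 = 0 ∧ e.2 ≠ 0 then (r.ρ (gaugeTransform h U e)).trace.re else 0)
      let cov : GaugeConfig 4 (2 * S + 1) G → (Site 4 (2 * S + 1) → G) →
          (Fin 3 → ZMod (2 * S + 1)) → ℝ := fun U h p =>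
        (∑ j : Fin 3, fro (∑ y : Fin 3 → ZMod (2 * S + 1),
          Complex.exp (-(2 * Real.pi * Complex.I *
            (∑ i : Fin 3, ((p i).val : ℂ) * ((y i).val : ℂ)) / (2 * S + 1 : ℂ))) •
          ((1 / 2 : ℂ) • (r.ρ (gaugeTransform h U (Fin.cons (0 : ZMod (2 * S + 1)) y, j.succ)) -
            (r.ρ (gaugeTransform h U (Fin.cons (0 : ZMod (2 * S + 1)) y, j.succ)))ᴴ)))) /
          ((2 * S + 1 : ℝ) ^ 3)
      let Dp : (Fin 3 → ZMod (2 * S + 1)) → ℝ := fun p =>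
        ∫ U, (⨆ h : {h : Site 4 (2 * S + 1) → G // ∀ h', coul U h ≤ coul U h'}, cov U h.1 p) ∂μ
      let slope : (GaugeConfig 4 (2 * S + 1) G → ℝ) → GaugeConfig 4 (2 * S + 1) G →
          Edge 4 (2 * S + 1) → ℝ := fun f U e =>
        Filter.limsup (fun g : G => |f (Function.update U e g) - f U| /
          Real.sqrt (fro (r.ρ g - r.ρ (U e)))) (𝓝[≠] (U e))
      let dir : (GaugeConfig 4 (2 * S + 1) G → ℝ) → ℝ := fun f =>
        ∑ e : Edge 4 (2 * S + 1), (if e.1 0 = 0 ∧ e.2 ≠ 0 then ∫ U, (slope f U e) ^ 2 ∂μ else 0)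
      let pn : (Fin 3 → ZMod (2 * S + 1)) → ℕ := fun p =>
        Finset.univ.sup fun i => ((p i).valMinAbs).natAbs
      let Dsh : ℕ → ℝ := fun k =>
        ⨆ p : {p : Fin 3 → ZMod (2 * S + 1) // S / 2 ^ (k + 1) < pn p ∧ pn p ≤ S / 2 ^ k}, Dp p.1
      let DUV : ℕ → ℝ := fun k =>
        ⨆ p : {p : Fin 3 → ZMod (2 * S + 1) // S / 2 ^ (k + 1) < pn p}, Dp p.1
      let Kmax : ℕ := Nat.log 2 (2 * S + 1)
      let T : ℕ → ℕ := fun j => (2 * S + 1) / 2 ^ j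
      let taxi : (j : ℕ) → (Fin 4 → Fin (2 ^ j)) → List (Fin 4) := fun _ w =>
        ((List.finRange 4).map fun i => List.replicate (w i).val i).flatten
      let bavg : (j : ℕ) → GaugeConfig 4 (2 * S + 1) G → Edge 4 (T j) → Fin r.N → Fin r.N → ℂ :=
        fun j U e a b =>
          (((2 ^ j) ^ 4 : ℕ) : ℂ)⁻¹ *
            ∑ w : Fin 4 → Fin (2 ^ j),
              r.ρ (transport U (unevenCorner (2 ^ j) (2 * S + 1) (T j) e.1) (taxi j w) *
                  transport U (pathEnd (unevenCorner (2 ^ j) (2 * S + 1) (T j) e.1) (taxi j w))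
                    (List.replicate (unevenLen (2 ^ j) (2 * S + 1) (T j) e.1 e.2) e.2) *
                  (transport U (unevenCorner (2 ^ j) (2 * S + 1) (T j) (e.1.shift e.2))
                    (taxi j w))⁻¹) a b
      let m : ℕ → MeasurableSpace (GaugeConfig 4 (2 * S + 1) G) := fun k =>
        ⨆ j ∈ Finset.Icc k Kmax, MeasurableSpace.comap (bavg j) inferInstance
      let LocalAt : ℕ → (GaugeConfig 4 (2 * S + 1) G → ℝ) → Prop := fun ℓ g =>
        ∃ x₀ : Fin 3 → ZMod (2 * S + 1), ∀ U V : GaugeConfig 4 (2 * S + 1) G,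
          (∀ e : Edge 4 (2 * S + 1), e.1 0 = 0 → e.2 ≠ 0 →
            (∀ i : Fin 3, (e.1 i.succ - x₀ i).val < ℓ) → U e = V e) → g U = g V
      ∀ K : ℕ, K ≤ Kmax → (∀ k < K, (5 / 4 : ℝ) * Dsh k ≤ Dsh (k + 1)) →
        (Dsh (K + 1) < (5 / 4 : ℝ) * Dsh K ∨ K = Kmax) →
      ∀ Λ : ℝ, 0 ≤ Λ →
        (∀ g : GaugeConfig 4 (2 * S + 1) G → ℝ, IsGaugeInvariant g →
          LocalAt (min (c₀ * 2 ^ (K - A)) S) g →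
          (∃ Kg : ℝ, ∀ U V : GaugeConfig 4 (2 * S + 1) G,
            |g U - g V| ≤ Kg * ∑ e, Real.sqrt (fro (r.ρ (U e) - r.ρ (V e)))) →
          ∫ U, (g U - ∫ V, g V ∂μ) ^ 2 ∂μ ≤ Λ * dir g) →
      ∀ f : GaugeConfig 4 (2 * S + 1) G → ℝ, IsGaugeInvariant f →
        (∀ U V : GaugeConfig 4 (2 * S + 1) G,
          (∀ e : Edge 4 (2 * S + 1), e.1 0 = 0 → e.2 ≠ 0 → U e = V e) → f U = f V) →
        (∃ Kf : ℝ, ∀ U V : GaugeConfig 4 (2 * S + 1) G,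
          |f U - f V| ≤ Kf * ∑ e, Real.sqrt (fro (r.ρ (U e) - r.ρ (V e)))) →
        ∫ U, (f U - (μ[f|m (K - A)]) U) ^ 2 ∂μ ≤ C_UV * (DUV (K - A) + Λ) * dir f := by
  sorry

/-- **Stub (PHYSICS — crossover, the last `A` scales below the peak; single-scale, finite blocks,
no small parameter).** For every buffer `A` there are `c₀ > 0` and `C_X > 0` such that for `β ≥ β₀`,
`S ≥ S₀(β)`, every peak scale `K` and every local Poincaré constant `Λ ≥ 0` at cubes of side
`≤ min(c₀ 2^K, S)`: `E_μ (E_μ[f | m (K−A)] − E_μ[f | m K])² ≤ C_X · (DUV K + Λ) · dir f` for all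
admissible `f` (the variance carried by the block averages between the scales `2^{K−A}` and `2^K`
costs the covariance above the peak scale, `DUV K ≥ Dsh K`). [folklore] -/
theorem stub_crossover :
    ∀ (G : Type) [Group G] [TopologicalSpace G] [IsTopologicalGroup G] [CompactSpace G]
      [MeasurableSpace G] [BorelSpace G], IsCompactSimpleLieGroup G → ∀ r : LatticeRep G,
      ∀ A : ℕ, ∃ c₀ : ℕ, ∃ C_X : ℝ, 0 < c₀ ∧ 0 < C_X ∧ ∃ β₀ : ℝ, ∀ β : ℝ, β₀ ≤ β →
      ∃ S₀ : ℕ, ∀ S : ℕ, S₀ ≤ S →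
      let μ := wilsonMeasure (d := 4) (L := 2 * S + 1) r.ρ β
      let fro : Matrix (Fin r.N) (Fin r.N) ℂ → ℝ := fun M => ∑ a, ∑ b, ‖M a b‖ ^ 2
      let coul : GaugeConfig 4 (2 * S + 1) G → (Site 4 (2 * S + 1) → G) → ℝ := fun U h =>
        -∑ e : Edge 4 (2 * S + 1),
          (if e.1 0 = 0 ∧ e.2 ≠ 0 then (r.ρ (gaugeTransform h U e)).trace.re else 0)
      let cov : GaugeConfig 4 (2 * S + 1) G → (Site 4 (2 * S + 1) → G) →
          (Fin 3 → ZMod (2 * S + 1)) → ℝ := fun U h p =>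
        (∑ j : Fin 3, fro (∑ y : Fin 3 → ZMod (2 * S + 1),
          Complex.exp (-(2 * Real.pi * Complex.I *
            (∑ i : Fin 3, ((p i).val : ℂ) * ((y i).val : ℂ)) / (2 * S + 1 : ℂ))) •
          ((1 / 2 : ℂ) • (r.ρ (gaugeTransform h U (Fin.cons (0 : ZMod (2 * S + 1)) y, j.succ)) -
            (r.ρ (gaugeTransform h U (Fin.cons (0 : ZMod (2 * S + 1)) y, j.succ)))ᴴ)))) /
          ((2 * S + 1 : ℝ) ^ 3)
      let Dp : (Fin 3 → ZMod (2 * S + 1)) → ℝ := fun p =>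
        ∫ U, (⨆ h : {h : Site 4 (2 * S + 1) → G // ∀ h', coul U h ≤ coul U h'}, cov U h.1 p) ∂μ
      let slope : (GaugeConfig 4 (2 * S + 1) G → ℝ) → GaugeConfig 4 (2 * S + 1) G →
          Edge 4 (2 * S + 1) → ℝ := fun f U e =>
        Filter.limsup (fun g : G => |f (Function.update U e g) - f U| /
          Real.sqrt (fro (r.ρ g - r.ρ (U e)))) (𝓝[≠] (U e))
      let dir : (GaugeConfig 4 (2 * S + 1) G → ℝ) → ℝ := fun f =>
        ∑ e : Edge 4 (2 * S + 1), (if e.1 0 = 0 ∧ e.2 ≠ 0 then ∫ U, (slope f U e) ^ 2 ∂μ else 0)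
      let pn : (Fin 3 → ZMod (2 * S + 1)) → ℕ := fun p =>
        Finset.univ.sup fun i => ((p i).valMinAbs).natAbs
      let Dsh : ℕ → ℝ := fun k =>
        ⨆ p : {p : Fin 3 → ZMod (2 * S + 1) // S / 2 ^ (k + 1) < pn p ∧ pn p ≤ S / 2 ^ k}, Dp p.1
      let DUV : ℕ → ℝ := fun k =>
        ⨆ p : {p : Fin 3 → ZMod (2 * S + 1) // S / 2 ^ (k + 1) < pn p}, Dp p.1
      let Kmax : ℕ := Nat.log 2 (2 * S + 1)
      let T : ℕ → ℕ := fun j => (2 * S + 1) / 2 ^ j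
      let taxi : (j : ℕ) → (Fin 4 → Fin (2 ^ j)) → List (Fin 4) := fun _ w =>
        ((List.finRange 4).map fun i => List.replicate (w i).val i).flatten
      let bavg : (j : ℕ) → GaugeConfig 4 (2 * S + 1) G → Edge 4 (T j) → Fin r.N → Fin r.N → ℂ :=
        fun j U e a b =>
          (((2 ^ j) ^ 4 : ℕ) : ℂ)⁻¹ *
            ∑ w : Fin 4 → Fin (2 ^ j),
              r.ρ (transport U (unevenCorner (2 ^ j) (2 * S + 1) (T j) e.1) (taxi j w) *
                  transport U (pathEnd (unevenCorner (2 ^ j) (2 * S + 1) (T j) e.1) (taxi j w))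
                    (List.replicate (unevenLen (2 ^ j) (2 * S + 1) (T j) e.1 e.2) e.2) *
                  (transport U (unevenCorner (2 ^ j) (2 * S + 1) (T j) (e.1.shift e.2))
                    (taxi j w))⁻¹) a b
      let m : ℕ → MeasurableSpace (GaugeConfig 4 (2 * S + 1) G) := fun k =>
        ⨆ j ∈ Finset.Icc k Kmax, MeasurableSpace.comap (bavg j) inferInstance
      let LocalAt : ℕ → (GaugeConfig 4 (2 * S + 1) G → ℝ) → Prop := fun ℓ g =>
        ∃ x₀ : Fin 3 → ZMod (2 * S + 1), ∀ U V : GaugeConfig 4 (2 * S + 1) G,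
          (∀ e : Edge 4 (2 * S + 1), e.1 0 = 0 → e.2 ≠ 0 →
            (∀ i : Fin 3, (e.1 i.succ - x₀ i).val < ℓ) → U e = V e) → g U = g V
      ∀ K : ℕ, K ≤ Kmax → (∀ k < K, (5 / 4 : ℝ) * Dsh k ≤ Dsh (k + 1)) →
        (Dsh (K + 1) < (5 / 4 : ℝ) * Dsh K ∨ K = Kmax) →
      ∀ Λ : ℝ, 0 ≤ Λ →
        (∀ g : GaugeConfig 4 (2 * S + 1) G → ℝ, IsGaugeInvariant g →
          LocalAt (min (c₀ * 2 ^ K) S) g →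
          (∃ Kg : ℝ, ∀ U V : GaugeConfig 4 (2 * S + 1) G,
            |g U - g V| ≤ Kg * ∑ e, Real.sqrt (fro (r.ρ (U e) - r.ρ (V e)))) →
          ∫ U, (g U - ∫ V, g V ∂μ) ^ 2 ∂μ ≤ Λ * dir g) →
      ∀ f : GaugeConfig 4 (2 * S + 1) G → ℝ, IsGaugeInvariant f →
        (∀ U V : GaugeConfig 4 (2 * S + 1) G,
          (∀ e : Edge 4 (2 * S + 1), e.1 0 = 0 → e.2 ≠ 0 → U e = V e) → f U = f V) →
        (∃ Kf : ℝ, ∀ U V : GaugeConfig 4 (2 * S + 1) G,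
          |f U - f V| ≤ Kf * ∑ e, Real.sqrt (fro (r.ρ (U e) - r.ρ (V e)))) →
        ∫ U, ((μ[f|m (K - A)]) U - (μ[f|m K]) U) ^ 2 ∂μ ≤ C_X * (DUV K + Λ) * dir f := by
  sorry

/-- **Stub (PHYSICS — local relaxation; implied by the crux, strictly weaker).** For every locality
factor `c₀ > 0` there is `C_T > 0` such that for `β ≥ β₀`, `S ≥ S₀(β)` and every peak scale `K`:
gauge-invariant link-Lipschitz functions `g` of the time-zero spatial links of ONE spatial cube of
side `≤ min(c₀ 2^K, S)` satisfy `Var_μ g ≤ C_T · Dmax · dir g` (Disproof F3's trap battleground: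
β-uniform `C_T` iff `Dmax(β,S)` outgrows the local trap depth). [folklore] -/
theorem stub_localRelaxation :
    ∀ (G : Type) [Group G] [TopologicalSpace G] [IsTopologicalGroup G] [CompactSpace G]
      [MeasurableSpace G] [BorelSpace G], IsCompactSimpleLieGroup G → ∀ r : LatticeRep G,
      ∀ c₀ : ℕ, 0 < c₀ → ∃ C_T : ℝ, 0 < C_T ∧ ∃ β₀ : ℝ, ∀ β : ℝ, β₀ ≤ β →
      ∃ S₀ : ℕ, ∀ S : ℕ, S₀ ≤ S →
      let μ := wilsonMeasure (d := 4) (L := 2 * S + 1) r.ρ β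
      let fro : Matrix (Fin r.N) (Fin r.N) ℂ → ℝ := fun M => ∑ a, ∑ b, ‖M a b‖ ^ 2
      let coul : GaugeConfig 4 (2 * S + 1) G → (Site 4 (2 * S + 1) → G) → ℝ := fun U h =>
        -∑ e : Edge 4 (2 * S + 1),
          (if e.1 0 = 0 ∧ e.2 ≠ 0 then (r.ρ (gaugeTransform h U e)).trace.re else 0)
      let cov : GaugeConfig 4 (2 * S + 1) G → (Site 4 (2 * S + 1) → G) →
          (Fin 3 → ZMod (2 * S + 1)) → ℝ := fun U h p =>
        (∑ j : Fin 3, fro (∑ y : Fin 3 → ZMod (2 * S + 1),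
          Complex.exp (-(2 * Real.pi * Complex.I *
            (∑ i : Fin 3, ((p i).val : ℂ) * ((y i).val : ℂ)) / (2 * S + 1 : ℂ))) •
          ((1 / 2 : ℂ) • (r.ρ (gaugeTransform h U (Fin.cons (0 : ZMod (2 * S + 1)) y, j.succ)) -
            (r.ρ (gaugeTransform h U (Fin.cons (0 : ZMod (2 * S + 1)) y, j.succ)))ᴴ)))) /
          ((2 * S + 1 : ℝ) ^ 3)
      let Dp : (Fin 3 → ZMod (2 * S + 1)) → ℝ := fun p =>
        ∫ U, (⨆ h : {h : Site 4 (2 * S + 1) → G // ∀ h', coul U h ≤ coul U h'}, cov U h.1 p) ∂μ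
      let Dmax : ℝ := ⨆ p : Fin 3 → ZMod (2 * S + 1), Dp p
      let slope : (GaugeConfig 4 (2 * S + 1) G → ℝ) → GaugeConfig 4 (2 * S + 1) G →
          Edge 4 (2 * S + 1) → ℝ := fun f U e =>
        Filter.limsup (fun g : G => |f (Function.update U e g) - f U| /
          Real.sqrt (fro (r.ρ g - r.ρ (U e)))) (𝓝[≠] (U e))
      let dir : (GaugeConfig 4 (2 * S + 1) G → ℝ) → ℝ := fun f =>
        ∑ e : Edge 4 (2 * S + 1), (if e.1 0 = 0 ∧ e.2 ≠ 0 then ∫ U, (slope f U e) ^ 2 ∂μ else 0)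
      let pn : (Fin 3 → ZMod (2 * S + 1)) → ℕ := fun p =>
        Finset.univ.sup fun i => ((p i).valMinAbs).natAbs
      let Dsh : ℕ → ℝ := fun k =>
        ⨆ p : {p : Fin 3 → ZMod (2 * S + 1) // S / 2 ^ (k + 1) < pn p ∧ pn p ≤ S / 2 ^ k}, Dp p.1
      let Kmax : ℕ := Nat.log 2 (2 * S + 1)
      let LocalAt : ℕ → (GaugeConfig 4 (2 * S + 1) G → ℝ) → Prop := fun ℓ g =>
        ∃ x₀ : Fin 3 → ZMod (2 * S + 1), ∀ U V : GaugeConfig 4 (2 * S + 1) G,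
          (∀ e : Edge 4 (2 * S + 1), e.1 0 = 0 → e.2 ≠ 0 →
            (∀ i : Fin 3, (e.1 i.succ - x₀ i).val < ℓ) → U e = V e) → g U = g V
      ∀ K : ℕ, K ≤ Kmax → (∀ k < K, (5 / 4 : ℝ) * Dsh k ≤ Dsh (k + 1)) →
        (Dsh (K + 1) < (5 / 4 : ℝ) * Dsh K ∨ K = Kmax) →
      ∀ g : GaugeConfig 4 (2 * S + 1) G → ℝ, IsGaugeInvariant g →
        LocalAt (min (c₀ * 2 ^ K) S) g →
        (∃ Kg : ℝ, ∀ U V : GaugeConfig 4 (2 * S + 1) G,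
          |g U - g V| ≤ Kg * ∑ e, Real.sqrt (fro (r.ρ (U e) - r.ρ (V e)))) →
        ∫ U, (g U - ∫ V, g V ∂μ) ^ 2 ∂μ ≤ C_T * Dmax * dir g := by
  sorry

/-- **Stub (PHYSICS — coarse Poincaré inequality at the peak scale; TARGET strength, implied by the
crux since `Var(E[f|m K]) ≤ Var f`).** There is `C_IR > 0` such that for `β ≥ β₀`, `S ≥ S₀(β)`,
every peak scale `K` and every admissible `f`: `Var_μ (E_μ[f | m K]) ≤ C_IR · Dmax · dir f` — the
crux restricted to the variance carried by the `ξ`-coarse effective observable `f_K = E[f | m K]`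
(the weak-coupling, volume-uniform Poincaré constant of the effective theory at the scale where the
transverse covariance peaks). [folklore] -/
theorem stub_coarsePoincare :
    ∀ (G : Type) [Group G] [TopologicalSpace G] [IsTopologicalGroup G] [CompactSpace G]
      [MeasurableSpace G] [BorelSpace G], IsCompactSimpleLieGroup G → ∀ r : LatticeRep G,
      ∃ C_IR : ℝ, 0 < C_IR ∧ ∃ β₀ : ℝ, ∀ β : ℝ, β₀ ≤ β → ∃ S₀ : ℕ, ∀ S : ℕ, S₀ ≤ S →
      let μ := wilsonMeasure (d := 4) (L := 2 * S + 1) r.ρ β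
      let fro : Matrix (Fin r.N) (Fin r.N) ℂ → ℝ := fun M => ∑ a, ∑ b, ‖M a b‖ ^ 2
      let coul : GaugeConfig 4 (2 * S + 1) G → (Site 4 (2 * S + 1) → G) → ℝ := fun U h =>
        -∑ e : Edge 4 (2 * S + 1),
          (if e.1 0 = 0 ∧ e.2 ≠ 0 then (r.ρ (gaugeTransform h U e)).trace.re else 0)
      let cov : GaugeConfig 4 (2 * S + 1) G → (Site 4 (2 * S + 1) → G) →
          (Fin 3 → ZMod (2 * S + 1)) → ℝ := fun U h p =>
        (∑ j : Fin 3, fro (∑ y : Fin 3 → ZMod (2 * S + 1),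
          Complex.exp (-(2 * Real.pi * Complex.I *
            (∑ i : Fin 3, ((p i).val : ℂ) * ((y i).val : ℂ)) / (2 * S + 1 : ℂ))) •
          ((1 / 2 : ℂ) • (r.ρ (gaugeTransform h U (Fin.cons (0 : ZMod (2 * S + 1)) y, j.succ)) -
            (r.ρ (gaugeTransform h U (Fin.cons (0 : ZMod (2 * S + 1)) y, j.succ)))ᴴ)))) /
          ((2 * S + 1 : ℝ) ^ 3)
      let Dp : (Fin 3 → ZMod (2 * S + 1)) → ℝ := fun p =>
        ∫ U, (⨆ h : {h : Site 4 (2 * S + 1) → G // ∀ h', coul U h ≤ coul U h'}, cov U h.1 p) ∂μ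
      let Dmax : ℝ := ⨆ p : Fin 3 → ZMod (2 * S + 1), Dp p
      let slope : (GaugeConfig 4 (2 * S + 1) G → ℝ) → GaugeConfig 4 (2 * S + 1) G →
          Edge 4 (2 * S + 1) → ℝ := fun f U e =>
        Filter.limsup (fun g : G => |f (Function.update U e g) - f U| /
          Real.sqrt (fro (r.ρ g - r.ρ (U e)))) (𝓝[≠] (U e))
      let dir : (GaugeConfig 4 (2 * S + 1) G → ℝ) → ℝ := fun f =>
        ∑ e : Edge 4 (2 * S + 1), (if e.1 0 = 0 ∧ e.2 ≠ 0 then ∫ U, (slope f U e) ^ 2 ∂μ else 0)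
      let pn : (Fin 3 → ZMod (2 * S + 1)) → ℕ := fun p =>
        Finset.univ.sup fun i => ((p i).valMinAbs).natAbs
      let Dsh : ℕ → ℝ := fun k =>
        ⨆ p : {p : Fin 3 → ZMod (2 * S + 1) // S / 2 ^ (k + 1) < pn p ∧ pn p ≤ S / 2 ^ k}, Dp p.1
      let Kmax : ℕ := Nat.log 2 (2 * S + 1)
      let T : ℕ → ℕ := fun j => (2 * S + 1) / 2 ^ j
      let taxi : (j : ℕ) → (Fin 4 → Fin (2 ^ j)) → List (Fin 4) := fun _ w =>
        ((List.finRange 4).map fun i => List.replicate (w i).val i).flatten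
      let bavg : (j : ℕ) → GaugeConfig 4 (2 * S + 1) G → Edge 4 (T j) → Fin r.N → Fin r.N → ℂ :=
        fun j U e a b =>
          (((2 ^ j) ^ 4 : ℕ) : ℂ)⁻¹ *
            ∑ w : Fin 4 → Fin (2 ^ j),
              r.ρ (transport U (unevenCorner (2 ^ j) (2 * S + 1) (T j) e.1) (taxi j w) *
                  transport U (pathEnd (unevenCorner (2 ^ j) (2 * S + 1) (T j) e.1) (taxi j w))
                    (List.replicate (unevenLen (2 ^ j) (2 * S + 1) (T j) e.1 e.2) e.2) *
                  (transport U (unevenCorner (2 ^ j) (2 * S + 1) (T j) (e.1.shift e.2))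
                    (taxi j w))⁻¹) a b
      let m : ℕ → MeasurableSpace (GaugeConfig 4 (2 * S + 1) G) := fun k =>
        ⨆ j ∈ Finset.Icc k Kmax, MeasurableSpace.comap (bavg j) inferInstance
      ∀ K : ℕ, K ≤ Kmax → (∀ k < K, (5 / 4 : ℝ) * Dsh k ≤ Dsh (k + 1)) →
        (Dsh (K + 1) < (5 / 4 : ℝ) * Dsh K ∨ K = Kmax) →
      ∀ f : GaugeConfig 4 (2 * S + 1) G → ℝ, IsGaugeInvariant f →
        (∀ U V : GaugeConfig 4 (2 * S + 1) G,
          (∀ e : Edge 4 (2 * S + 1), e.1 0 = 0 → e.2 ≠ 0 → U e = V e) → f U = f V) →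
        (∃ Kf : ℝ, ∀ U V : GaugeConfig 4 (2 * S + 1) G,
          |f U - f V| ≤ Kf * ∑ e, Real.sqrt (fro (r.ρ (U e) - r.ρ (V e)))) →
        ∫ U, ((μ[f|m K]) U - ∫ V, f V ∂μ) ^ 2 ∂μ ≤ C_IR * Dmax * dir f := by
  sorry

/-! ### The kernel-checked composition -/

/-- **The crux from the stubs** (deciding theorem; its type is literally the route decl).
`C = C_UV (1 + C_T) + C_X (1 + C_T) + C_IR`: at `S ≥ S₀` pick the peak scale `K` by `Nat.find`
(first scale at which the shell covariance stops growing by `5/4`, or `Kmax`), take the local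
Poincaré constant `Λ = C_T · Dmax` from `stub_localRelaxation` (cubes of side
`≤ min(max(c₀,c₁) 2^K, S)` cover both smaller cube families), split
`Var f = E(f − E[f|m(K−A)])² + E(E[f|m(K−A)] − E[f|m K])² + Var(E[f|m K])` by
`stub_condVarTelescope` (the filtration is a decreasing family of sub-σ-algebras of the Borel one by
`stub_bavgMeasurable`, `f ∈ L²` by `stub_admissibleMemLp`, `μ` is a probability measure), bound the
three pieces by the three scale stubs and use `DUV k ≤ Dmax`, `0 ≤ Dmax`, `0 ≤ dir f`. [folklore] -/
theorem BrascampLiebVacuum_of :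
    Summit.QuantumFields.YangMills.Theses.ConvexGribovBody.BrascampLiebVacuum := by
  intro G _ _ _ _ _ _ hG r
  obtain ⟨A, c₀, C_UV, hc₀, hCUV, β₁, hUV⟩ := stub_uvCascade G hG r
  obtain ⟨c₁, C_X, hc₁, hCX, β₂, hX⟩ := stub_crossover G hG r A
  obtain ⟨C_T, hCT, β₃, hT⟩ :=
    stub_localRelaxation G hG r (max c₀ c₁) (lt_of_lt_of_le hc₀ (le_max_left _ _))
  obtain ⟨C_IR, hCIR, β₄, hIR⟩ := stub_coarsePoincare G hG r
  refine ⟨C_UV * (1 + C_T) + C_X * (1 + C_T) + C_IR, by positivity,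
    max (max β₁ β₂) (max β₃ β₄), fun β hβ => ?_⟩
  have hβ₁ : β₁ ≤ β := le_trans (le_trans (le_max_left _ _) (le_max_left _ _)) hβ
  have hβ₂ : β₂ ≤ β := le_trans (le_trans (le_max_right _ _) (le_max_left _ _)) hβ
  have hβ₃ : β₃ ≤ β := le_trans (le_trans (le_max_left _ _) (le_max_right _ _)) hβ
  have hβ₄ : β₄ ≤ β := le_trans (le_trans (le_max_right _ _) (le_max_right _ _)) hβ
  obtain ⟨S₁, hS₁⟩ := hUV β hβ₁
  obtain ⟨S₂, hS₂⟩ := hX β hβ₂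
  obtain ⟨S₃, hS₃⟩ := hT β hβ₃
  obtain ⟨S₄, hS₄⟩ := hIR β hβ₄
  refine ⟨max (max S₁ S₂) (max S₃ S₄), fun S hS => ?_⟩
  have hS₁' : S₁ ≤ S := le_trans (le_trans (le_max_left _ _) (le_max_left _ _)) hS
  have hS₂' : S₂ ≤ S := le_trans (le_trans (le_max_right _ _) (le_max_left _ _)) hS
  have hS₃' : S₃ ≤ S := le_trans (le_trans (le_max_left _ _) (le_max_right _ _)) hS
  have hS₄' : S₄ ≤ S := le_trans (le_trans (le_max_right _ _) (le_max_right _ _)) hS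
  intro μ fro coul cov Dmax slope dir f hf₁ hf₂ hf₃
  -- the line's objects, verbatim as in the stubs
  let Dp : (Fin 3 → ZMod (2 * S + 1)) → ℝ := fun p =>
    ∫ U, (⨆ h : {h : Site 4 (2 * S + 1) → G // ∀ h', coul U h ≤ coul U h'}, cov U h.1 p) ∂μ
  let pn : (Fin 3 → ZMod (2 * S + 1)) → ℕ := fun p =>
    Finset.univ.sup fun i => ((p i).valMinAbs).natAbs
  let Dsh : ℕ → ℝ := fun k =>
    ⨆ p : {p : Fin 3 → ZMod (2 * S + 1) // S / 2 ^ (k + 1) < pn p ∧ pn p ≤ S / 2 ^ k}, Dp p.1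
  let DUV : ℕ → ℝ := fun k =>
    ⨆ p : {p : Fin 3 → ZMod (2 * S + 1) // S / 2 ^ (k + 1) < pn p}, Dp p.1
  let Kmax : ℕ := Nat.log 2 (2 * S + 1)
  let T : ℕ → ℕ := fun j => (2 * S + 1) / 2 ^ j
  let taxi : (j : ℕ) → (Fin 4 → Fin (2 ^ j)) → List (Fin 4) := fun _ w =>
    ((List.finRange 4).map fun i => List.replicate (w i).val i).flatten
  let bavg : (j : ℕ) → GaugeConfig 4 (2 * S + 1) G → Edge 4 (T j) → Fin r.N → Fin r.N → ℂ :=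
    fun j U e a b =>
      (((2 ^ j) ^ 4 : ℕ) : ℂ)⁻¹ *
        ∑ w : Fin 4 → Fin (2 ^ j),
          r.ρ (transport U (unevenCorner (2 ^ j) (2 * S + 1) (T j) e.1) (taxi j w) *
              transport U (pathEnd (unevenCorner (2 ^ j) (2 * S + 1) (T j) e.1) (taxi j w))
                (List.replicate (unevenLen (2 ^ j) (2 * S + 1) (T j) e.1 e.2) e.2) *
              (transport U (unevenCorner (2 ^ j) (2 * S + 1) (T j) (e.1.shift e.2))
                (taxi j w))⁻¹) a b
  let m : ℕ → MeasurableSpace (GaugeConfig 4 (2 * S + 1) G) := fun k =>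
    ⨆ j ∈ Finset.Icc k Kmax, MeasurableSpace.comap (bavg j) inferInstance
  -- the peak scale
  classical
  have hex : ∃ k, Dsh (k + 1) < (5 / 4 : ℝ) * Dsh k ∨ k = Kmax := ⟨Kmax, Or.inr rfl⟩
  let K : ℕ := Nat.find hex
  have hK : K ≤ Kmax := Nat.find_le (Or.inr rfl)
  have hstop : Dsh (K + 1) < (5 / 4 : ℝ) * Dsh K ∨ K = Kmax := Nat.find_spec hex
  have hgrowth : ∀ k < K, (5 / 4 : ℝ) * Dsh k ≤ Dsh (k + 1) := fun k hk => by
    have h := Nat.find_min hex hk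
    rw [not_or, not_lt] at h
    exact h.1
  -- signs and the comparison `DUV ≤ Dmax`
  have hdir : 0 ≤ dir f := by
    refine Finset.sum_nonneg fun e _ => ?_
    split_ifs
    · exact integral_nonneg fun U => sq_nonneg _
    · exact le_rfl
  have hcov : ∀ U h p, 0 ≤ cov U h p := fun U h p => by
    refine div_nonneg (Finset.sum_nonneg fun j _ => ?_) (by positivity)
    exact Finset.sum_nonneg fun a _ => Finset.sum_nonneg fun b _ => by positivity
  have hDp : ∀ p, 0 ≤ Dp p := fun p => integral_nonneg fun U => Real.iSup_nonneg fun h => hcov U h.1 p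
  have hD : 0 ≤ Dmax := Real.iSup_nonneg hDp
  have hDple : ∀ p, Dp p ≤ Dmax := fun p => le_ciSup (Finite.bddAbove_range Dp) p
  have hDUV : ∀ k, DUV k ≤ Dmax := fun k => Real.iSup_le (fun p => hDple p.1) hD
  -- the local Poincaré constant `Λ = C_T · Dmax`
  have hΛ : 0 ≤ C_T * Dmax := mul_nonneg hCT.le hD
  have hloc := hS₃ S hS₃' K hK hgrowth hstop
  have hpow : ∀ A' : ℕ, 2 ^ (K - A') ≤ 2 ^ K := fun A' => Nat.pow_le_pow_right two_pos (Nat.sub_le K A')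
  have hℓ₁ : min (c₀ * 2 ^ (K - A)) S ≤ min (max c₀ c₁ * 2 ^ K) S :=
    min_le_min_right S (Nat.mul_le_mul (le_max_left _ _) (hpow A))
  have hℓ₂ : min (c₁ * 2 ^ K) S ≤ min (max c₀ c₁ * 2 ^ K) S :=
    min_le_min_right S (Nat.mul_le_mul (le_max_right _ _) le_rfl)
  have hlocUV : ∀ g : GaugeConfig 4 (2 * S + 1) G → ℝ, IsGaugeInvariant g →
      (∃ x₀ : Fin 3 → ZMod (2 * S + 1), ∀ U V : GaugeConfig 4 (2 * S + 1) G,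
        (∀ e : Edge 4 (2 * S + 1), e.1 0 = 0 → e.2 ≠ 0 →
          (∀ i : Fin 3, (e.1 i.succ - x₀ i).val < min (c₀ * 2 ^ (K - A)) S) → U e = V e) →
          g U = g V) →
      (∃ Kg : ℝ, ∀ U V : GaugeConfig 4 (2 * S + 1) G,
        |g U - g V| ≤ Kg * ∑ e, Real.sqrt (fro (r.ρ (U e) - r.ρ (V e)))) →
      ∫ U, (g U - ∫ V, g V ∂μ) ^ 2 ∂μ ≤ C_T * Dmax * dir g := by
    intro g hg₁ hg₂ hg₃
    obtain ⟨x₀, hx⟩ := hg₂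
    exact hloc g hg₁ ⟨x₀, fun U V hUV => hx U V fun e h1 h2 h3 =>
      hUV e h1 h2 fun i => lt_of_lt_of_le (h3 i) hℓ₁⟩ hg₃
  have hlocX : ∀ g : GaugeConfig 4 (2 * S + 1) G → ℝ, IsGaugeInvariant g →
      (∃ x₀ : Fin 3 → ZMod (2 * S + 1), ∀ U V : GaugeConfig 4 (2 * S + 1) G,
        (∀ e : Edge 4 (2 * S + 1), e.1 0 = 0 → e.2 ≠ 0 →
          (∀ i : Fin 3, (e.1 i.succ - x₀ i).val < min (c₁ * 2 ^ K) S) → U e = V e) →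
          g U = g V) →
      (∃ Kg : ℝ, ∀ U V : GaugeConfig 4 (2 * S + 1) G,
        |g U - g V| ≤ Kg * ∑ e, Real.sqrt (fro (r.ρ (U e) - r.ρ (V e)))) →
      ∫ U, (g U - ∫ V, g V ∂μ) ^ 2 ∂μ ≤ C_T * Dmax * dir g := by
    intro g hg₁ hg₂ hg₃
    obtain ⟨x₀, hx⟩ := hg₂
    exact hloc g hg₁ ⟨x₀, fun U V hUV => hx U V fun e h1 h2 h3 =>
      hUV e h1 h2 fun i => lt_of_lt_of_le (h3 i) hℓ₂⟩ hg₃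
  -- the three scale pieces
  have hA : ∫ U, (f U - (μ[f|m (K - A)]) U) ^ 2 ∂μ ≤
      C_UV * (DUV (K - A) + C_T * Dmax) * dir f :=
    hS₁ S hS₁' K hK hgrowth hstop (C_T * Dmax) hΛ hlocUV f hf₁ hf₂ hf₃
  have hB : ∫ U, ((μ[f|m (K - A)]) U - (μ[f|m K]) U) ^ 2 ∂μ ≤
      C_X * (DUV K + C_T * Dmax) * dir f :=
    hS₂ S hS₂' K hK hgrowth hstop (C_T * Dmax) hΛ hlocX f hf₁ hf₂ hf₃
  have hC : ∫ U, ((μ[f|m K]) U - ∫ V, f V ∂μ) ^ 2 ∂μ ≤ C_IR * Dmax * dir f :=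
    hS₄ S hS₄' K hK hgrowth hstop f hf₁ hf₂ hf₃
  -- the variance martingale (M)
  haveI : IsProbabilityMeasure μ :=
    isProbabilityMeasure_wilsonMeasure (d := 4) (L := 2 * S + 1) r.ρ r.continuous β
  have hmeas : ∀ j, Measurable (bavg j) := fun j => stub_bavgMeasurable G r S j
  have hm₁ : m (K - A) ≤ (inferInstance : MeasurableSpace (GaugeConfig 4 (2 * S + 1) G)) :=
    iSup₂_le fun j _ => (hmeas j).comap_le
  have hm₂₁ : m K ≤ m (K - A) := by
    refine biSup_mono fun j hj => ?_
    rw [Finset.mem_Icc] at hj ⊢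
    exact ⟨le_trans (Nat.sub_le K A) hj.1, hj.2⟩
  have hfL2 : MemLp f 2 μ := stub_admissibleMemLp G r β S f hf₃
  have hM := stub_condVarTelescope μ (m (K - A)) (m K) hm₁ hm₂₁ f hfL2
  -- assemble
  have h1 : C_UV * (DUV (K - A) + C_T * Dmax) * dir f ≤ C_UV * (1 + C_T) * Dmax * dir f := by
    have h : DUV (K - A) + C_T * Dmax ≤ (1 + C_T) * Dmax := by
      have := hDUV (K - A)
      linarith
    calc C_UV * (DUV (K - A) + C_T * Dmax) * dir f
        ≤ C_UV * ((1 + C_T) * Dmax) * dir f :=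
          mul_le_mul_of_nonneg_right (mul_le_mul_of_nonneg_left h hCUV.le) hdir
      _ = C_UV * (1 + C_T) * Dmax * dir f := by ring
  have h2 : C_X * (DUV K + C_T * Dmax) * dir f ≤ C_X * (1 + C_T) * Dmax * dir f := by
    have h : DUV K + C_T * Dmax ≤ (1 + C_T) * Dmax := by
      have := hDUV K
      linarith
    calc C_X * (DUV K + C_T * Dmax) * dir f
        ≤ C_X * ((1 + C_T) * Dmax) * dir f :=
          mul_le_mul_of_nonneg_right (mul_le_mul_of_nonneg_left h hCX.le) hdir
      _ = C_X * (1 + C_T) * Dmax * dir f := by ring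
  calc ∫ U, (f U - ∫ V, f V ∂μ) ^ 2 ∂μ
      = ∫ U, (f U - (μ[f|m (K - A)]) U) ^ 2 ∂μ +
          ∫ U, ((μ[f|m (K - A)]) U - (μ[f|m K]) U) ^ 2 ∂μ +
          ∫ U, ((μ[f|m K]) U - ∫ V, f V ∂μ) ^ 2 ∂μ := hM
    _ ≤ C_UV * (1 + C_T) * Dmax * dir f + C_X * (1 + C_T) * Dmax * dir f +
          C_IR * Dmax * dir f := add_le_add (add_le_add (hA.trans h1) (hB.trans h2)) hC
    _ = (C_UV * (1 + C_T) + C_X * (1 + C_T) + C_IR) * Dmax * dir f := by ring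

end Summit.QuantumFields.YangMills.Theorems.BrascampLiebVacuum

end
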